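import Mathlib
import Summits.Schanuel.Schanuel.Theorems.AclSubsetLogFreeCore.Negative.LogFreeCoreCountable
import Literature.Barriers.Schanuel.LargeTranscendenceDegreeThm29Holds
import Literature.Barriers.Schanuel.LargeTranscendenceDegreeSmallTrdegProofs
import Literature.NumberTheory.Transcendental.OneMotiveToricProofs

/-!
# Line `kernel-tower-relative-lw` (route `RigidCore`): six exponentials over `L₀ = ℚ(2πi)^{ralg}`

Registered stub `stub_sixExponentialsStageZero` of line `kernel-tower-relative-lw` of crux
`stmt-Schanuel-0970` (`Summit.Schanuel.Schanuel.Theses.RigidCore.SchanuelOnLogFreeCore`, (R) =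
Schanuel's conjecture for `ℚ`-linearly independent tuples from the log-free core).  The first
level of the kernel tower is `L₀ = stage 0 = ℚ(2πi)^{ralg}` (tree objects `stage`, `relAlg` of
`Theorems/AclSubsetLogFreeCore/Negative/LogFreeCoreObjects.lean`); the line's first open layer
`RelLW₀` predicts `e^a ∉ L₀` for every `a ∈ L₀ ∖ ℚ·2πi` (open already for `a = 1`: `e ⊥ π`).
This file proves an unconditional DISJUNCTION of such instances — "six exponentials over
`ℚ(π)^{ralg}`": for a `ℚ`-free pair `x` and a `ℚ`-free triple `y` from `L₀`, not all six
`e^{xᵢyⱼ}` lie in `L₀` (`stub_sixExponentialsStageZero`, signature verbatim).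

Proof.
1. `KernelTower.trdeg_le_one_of_le_stage_zero`: every intermediate field `E ≤ L₀` has
   `trdeg_ℚ E ≤ 1`.  Indeed `L₀ = F^{ralg}` with `F = ℚ(2πi)` is algebraic over `F`
   (Mathlib `algebraicClosure.isAlgebraic`), so by the tower law (`trdeg_add_eq`,
   `trdeg_eq_zero`) `trdeg_ℚ F^{ralg} = trdeg_ℚ F ≤ 1`
   (`Literature.Barriers.Schanuel.trdeg_adjoin_singleton_le_one`), and `E` embeds into `F^{ralg}`.
2. If all `xᵢ, yⱼ, e^{xᵢyⱼ}` were in `L₀`, then `K₂ = ℚ(x, y, e^{xᵢyⱼ}) = gridField₂ x y ≤ L₀`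
   would have `trdeg ≤ 1`, contradicting the PROVED `t₂`-clause of LNM 1752, Ch. 14, Theorem 2.9
   with `d = 2`, `ℓ = 3` (`3 + 2 < 6`): `Literature.Barriers.Schanuel.two_le_trdeg_gridField₂`
   (discharged in tree by `smallTrdeg_thm_2_9_pos_holds`).
3. The flagship instance `x = (1, πi)`, `y = (1, πi, π²)`
   (`KernelTower.exp_one_or_exp_pi_sq_or_exp_I_pi_cube_not_mem_stage_zero`): the six products are
   `1, πi, π², πi, −π², iπ³`, the exponentials `e, −1, e^{π²}, −1, e^{−π²}, e^{iπ³}`; `−1 ∈ L₀` and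
   `e^{−π²} ∈ L₀ ↔ e^{π²} ∈ L₀`, so at least one of `e`, `e^{π²}`, `e^{iπ³}` is outside `L₀` —
   i.e. transcendental over `ℚ(π)`.  The `ℚ`-freeness of `(1, πi, π²)` is the transcendence of
   `π` (`Literature.NumberTheory.Transcendental.transcendental_pi_holds`).
4. The `e`-free companion `x = (πi, π²)`, `y = (1, πi, π²)`
   (`KernelTower.exp_pi_sq_or_exp_I_pi_cube_or_exp_pi_fourth_not_mem_stage_zero`): at least one of
   `e^{π²}`, `e^{iπ³}`, `e^{π⁴}` is outside `L₀`.

Everything used is proved in the tree / Mathlib (no named-fact hypotheses).  No new definitions.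
NOT claimed: which of the numbers is transcendental over `ℚ(π)` (each single instance is open:
`u = 1` is `e ⊥ π`; `u = π²` contains `e^{π²} ∉ ℚ̄`).

## References

* [NesterenkoPhilippon2001] Yu. V. Nesterenko, P. Philippon (eds.), *Introduction to Algebraic
  Independence Theory*, LNM 1752 (2001), Ch. 14 Theorem 2.9 (`t₂`-clause), p. 216 (PDF p. 249).
-/

noncomputable section

open Summit.Schanuel.Schanuel.Theorems.AclSubsetLogFreeCore.Negative

namespace Summit.Schanuel.Schanuel.Theorems.RigidCore

/-! ### The key count: subfields of `L₀` have transcendence degree `≤ 1` -/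

/-- `trdeg_ℚ ℚ(2πi)^{ralg} ≤ 1`, for the relative algebraic closure taken as an intermediate field
over `F = ℚ(2πi)`: tower law `trdeg_ℚ F + trdeg_F F^{ralg} = trdeg_ℚ F^{ralg}` with
`trdeg_F F^{ralg} = 0` (algebraic) and `trdeg_ℚ F ≤ 1` (one generator). [folklore] -/
theorem KernelTower.trdeg_algebraicClosure_adjoin_two_pi_I_le_one :
    Algebra.trdeg ℚ
        ↥(algebraicClosure
            (↥(IntermediateField.adjoin ℚ ({(2 * ↑Real.pi * Complex.I : ℂ)} : Set ℂ))) ℂ) ≤ 1 := by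
  set F : IntermediateField ℚ ℂ :=
    IntermediateField.adjoin ℚ ({(2 * ↑Real.pi * Complex.I : ℂ)} : Set ℂ)
  have htower := trdeg_add_eq ℚ F (A := ↥(algebraicClosure F ℂ))
  have h0 : Algebra.trdeg F ↥(algebraicClosure F ℂ) = 0 := trdeg_eq_zero
  rw [h0, add_zero] at htower
  rw [← htower]
  exact Literature.Barriers.Schanuel.trdeg_adjoin_singleton_le_one _

/-- **Every intermediate field `E ≤ L₀ = stage 0` has `trdeg_ℚ E ≤ 1`** (`stage 0` is, as a set,
the relative algebraic closure of `ℚ(2πi)` in `ℂ`, into which `E` embeds `ℚ`-algebraically).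
[folklore] -/
theorem KernelTower.trdeg_le_one_of_le_stage_zero {E : IntermediateField ℚ ℂ} (hE : E ≤ stage 0) :
    Algebra.trdeg ℚ E ≤ 1 := by
  set F : IntermediateField ℚ ℂ :=
    IntermediateField.adjoin ℚ ({(2 * ↑Real.pi * Complex.I : ℂ)} : Set ℂ)
  have hE' : ∀ z ∈ E, z ∈ algebraicClosure F ℂ := fun z hz =>
    (IntermediateField.mem_restrictScalars ℚ).1 (hE hz)
  let f : E →ₐ[ℚ] ↥(algebraicClosure F ℂ) :=
    { toFun := fun z => ⟨z.1, hE' z.1 z.2⟩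
      map_one' := rfl
      map_mul' := fun _ _ => rfl
      map_zero' := rfl
      map_add' := fun _ _ => rfl
      commutes' := fun _ => rfl }
  have hf : Function.Injective f := by
    intro a b hab
    have h := congrArg Subtype.val hab
    exact Subtype.ext h
  exact (trdeg_le_of_injective f hf).trans
    KernelTower.trdeg_algebraicClosure_adjoin_two_pi_I_le_one

/-- In particular `trdeg_ℚ L₀ ≤ 1` for `L₀ = stage 0 = ℚ(2πi)^{ralg}`. [folklore] -/
theorem KernelTower.trdeg_stage_zero_le_one : Algebra.trdeg ℚ ↥(stage 0) ≤ 1 :=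
  KernelTower.trdeg_le_one_of_le_stage_zero le_rfl

/-! ### The stub: six exponentials over `L₀` -/

/-- **Stub `stub_sixExponentialsStageZero` of line `kernel-tower-relative-lw`** (registered on
`stmt-Schanuel-0970`, signature verbatim) — **six exponentials over `ℚ(π)^{ralg}`**: for a
`ℚ`-linearly independent pair `x` and a `ℚ`-linearly independent triple `y` of elements of
`L₀ = stage 0`, at least one of the six numbers `e^{xᵢyⱼ}` lies outside `L₀`.  Otherwise
`K₂ = ℚ(x, y, e^{xᵢyⱼ}) ≤ L₀` would have transcendence degree `≤ 1`
(`KernelTower.trdeg_le_one_of_le_stage_zero`), against `trdeg_ℚ K₂ ≥ 2` — the `t₂`-clause of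
LNM 1752, Ch. 14, Theorem 2.9 with `d = 2`, `ℓ = 3`, `ℓ + d = 5 < 6 = dℓ`, PROVED in the tree
(`Literature.Barriers.Schanuel.two_le_trdeg_gridField₂`).
[cite: NesterenkoPhilippon2001, Ch. 14 Theorem 2.9] -/
theorem stub_sixExponentialsStageZero :
    ∀ (x : Fin 2 → ℂ) (y : Fin 3 → ℂ), (∀ i, x i ∈ stage 0) → (∀ j, y j ∈ stage 0) →
      LinearIndependent ℚ x → LinearIndependent ℚ y →
        ∃ i j, Complex.exp (x i * y j) ∉ stage 0 := by
  intro x y hx hy hlx hly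
  by_contra hne
  push Not at hne
  have hle : Literature.Barriers.Schanuel.gridField₂ x y ≤ stage 0 := by
    rw [Literature.Barriers.Schanuel.gridField₂, IntermediateField.adjoin_le_iff]
    rintro z ((⟨i, rfl⟩ | ⟨j, rfl⟩) | ⟨p, rfl⟩)
    · exact hx i
    · exact hy j
    · exact hne p.1 p.2
  have h2 := Literature.Barriers.Schanuel.two_le_trdeg_gridField₂ x y hlx hly (by norm_num)
  have h21 := h2.trans (KernelTower.trdeg_le_one_of_le_stage_zero hle)
  norm_num at h21

/-! ### The instances `x = (1, πi)` or `(πi, π²)`, `y = (1, πi, π²)` -/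

namespace SixExpStageZero

/-- `πi = 2πi / 2 ∈ L₀`. [folklore] -/
theorem pi_mul_I_mem : (↑Real.pi * Complex.I : ℂ) ∈ stage 0 := by
  have h2 : (2 : ℂ) ∈ stage 0 := by
    have h := add_mem (one_mem (stage 0)) (one_mem (stage 0))
    rwa [one_add_one_eq_two] at h
  have h := div_mem two_pi_I_mem_stage_zero h2
  have e : (2 * ↑Real.pi * Complex.I : ℂ) / 2 = ↑Real.pi * Complex.I := by ring
  rwa [e] at h

/-- `π² = −(πi)² ∈ L₀`. [folklore] -/
theorem pi_sq_mem : ((Real.pi : ℂ) ^ 2) ∈ stage 0 := by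
  have h := neg_mem (pow_mem pi_mul_I_mem 2)
  have e : -((↑Real.pi * Complex.I : ℂ) ^ 2) = (Real.pi : ℂ) ^ 2 := by
    rw [mul_pow, Complex.I_sq]; ring
  rwa [e] at h

/-- The pair `(1, πi)` is `ℚ`-linearly independent (imaginary part: `tπ = 0`). [folklore] -/
theorem linearIndependent_one_pi_mul_I :
    LinearIndependent ℚ ![(1 : ℂ), ↑Real.pi * Complex.I] := by
  refine LinearIndependent.pair_iff.mpr fun s t hst => ?_
  rw [Rat.smul_def, Rat.smul_def, mul_one] at hst
  have hre := congrArg Complex.re hst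
  have him := congrArg Complex.im hst
  simp only [Complex.add_re, Complex.ratCast_re, Complex.mul_re, Complex.ratCast_im,
    Complex.mul_im, Complex.ofReal_re, Complex.ofReal_im, Complex.I_re, Complex.I_im,
    Complex.add_im, Complex.zero_re, Complex.zero_im, mul_zero, mul_one, zero_mul,
    add_zero, zero_add, sub_self] at hre him
  refine ⟨by exact_mod_cast hre, ?_⟩
  have : (t : ℝ) = 0 := by
    rcases mul_eq_zero.1 him with h | h
    · exact h
    · exact absurd h Real.pi_ne_zero
  exact_mod_cast this

/-- The triple `(1, πi, π²)` is `ℚ`-linearly independent: a relation `a + bπi + cπ² = 0` has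
imaginary part `bπ = 0` and real part `a + cπ² = 0`, and `π²` is irrational since `π` is
transcendental (`Literature.NumberTheory.Transcendental.transcendental_pi_holds`). [folklore] -/
theorem linearIndependent_one_pi_mul_I_pi_sq :
    LinearIndependent ℚ ![(1 : ℂ), ↑Real.pi * Complex.I, (Real.pi : ℂ) ^ 2] := by
  have hπ : Transcendental ℚ Real.pi :=
    Literature.NumberTheory.Transcendental.transcendental_pi_holds
  rw [Fintype.linearIndependent_iff]
  intro g hg
  rw [Fin.sum_univ_three] at hg
  simp only [Matrix.cons_val_zero, Matrix.cons_val_one, Matrix.head_cons, Matrix.cons_val_two,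
    Matrix.tail_cons, Rat.smul_def, mul_one] at hg
  have hre := congrArg Complex.re hg
  have him := congrArg Complex.im hg
  simp only [sq, Complex.add_re, Complex.ratCast_re, Complex.mul_re, Complex.ratCast_im,
    Complex.mul_im, Complex.ofReal_re, Complex.ofReal_im, Complex.I_re, Complex.I_im,
    Complex.add_im, Complex.zero_re, Complex.zero_im, mul_zero, mul_one, zero_mul, sub_zero,
    add_zero, zero_add, sub_self] at hre him
  -- `him : g 1 * π = 0`, `hre : g 0 + g 2 * (π * π) = 0`
  have h1 : g 1 = 0 := by
    rcases mul_eq_zero.1 him with h | h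
    · exact_mod_cast h
    · exact absurd h Real.pi_ne_zero
  have h2 : g 2 = 0 := by
    by_contra h2
    apply hπ
    have hq : Real.pi ^ 2 = ((-(g 0) / g 2 : ℚ) : ℝ) := by
      have h2' : ((g 2 : ℚ) : ℝ) ≠ 0 := by exact_mod_cast h2
      push_cast
      field_simp
      linarith [hre]
    have halg : IsAlgebraic ℚ (Real.pi ^ 2) := by
      rw [hq]
      exact isAlgebraic_algebraMap (R := ℚ) (A := ℝ) (-(g 0) / g 2 : ℚ)
    exact IsAlgebraic.of_pow two_pos halg
  have h0 : g 0 = 0 := by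
    have : (g 0 : ℝ) = 0 := by
      have h2' : ((g 2 : ℚ) : ℝ) = 0 := by exact_mod_cast h2
      rw [h2', zero_mul, add_zero] at hre
      exact hre
    exact_mod_cast this
  intro i
  fin_cases i
  · exact h0
  · exact h1
  · exact h2

/-- The pair `(πi, π²)` is `ℚ`-linearly independent (imaginary part `sπ = 0`, real part
`tπ² = 0`). [folklore] -/
theorem linearIndependent_pi_mul_I_pi_sq :
    LinearIndependent ℚ ![(↑Real.pi * Complex.I : ℂ), (Real.pi : ℂ) ^ 2] := by
  refine LinearIndependent.pair_iff.mpr fun s t hst => ?_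
  rw [Rat.smul_def, Rat.smul_def] at hst
  have hre := congrArg Complex.re hst
  have him := congrArg Complex.im hst
  simp only [sq, Complex.add_re, Complex.ratCast_re, Complex.mul_re, Complex.ratCast_im,
    Complex.mul_im, Complex.ofReal_re, Complex.ofReal_im, Complex.I_re, Complex.I_im,
    Complex.add_im, Complex.zero_re, Complex.zero_im, mul_zero, mul_one, zero_mul,
    add_zero, zero_add, sub_self, sub_zero] at hre him
  -- `him : s * π = 0`, `hre : t * (π * π) = 0`
  have hs : (s : ℝ) = 0 := by
    rcases mul_eq_zero.1 him with h | h
    · exact h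
    · exact absurd h Real.pi_ne_zero
  have ht : (t : ℝ) = 0 := by
    rcases mul_eq_zero.1 hre with h | h
    · exact h
    · exact absurd h (mul_ne_zero Real.pi_ne_zero Real.pi_ne_zero)
  exact ⟨by exact_mod_cast hs, by exact_mod_cast ht⟩

end SixExpStageZero

/-- **At least one of `e`, `e^{π²}`, `e^{iπ³}` is transcendental over `ℚ(π)`** — precisely: not
all three lie in `L₀ = stage 0 = ℚ(2πi)^{ralg} = ℚ(π)^{ralg}`.  An unconditional disjunction of
three open instances of `RelLW₀` (`u = 1` is `e ⊥ π`; `u = π²` contains `e^{π²} ∉ ℚ̄`;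
`u = iπ³`), from `stub_sixExponentialsStageZero` at `x = (1, πi)`, `y = (1, πi, π²)`: the six
products are `1, πi, π², πi, −π², iπ³` with exponentials `e, −1, e^{π²}, −1, e^{−π²}, e^{iπ³}`,
and `−1 ∈ L₀`, `e^{−π²} = (e^{π²})⁻¹`. [cite: NesterenkoPhilippon2001, Ch. 14 Theorem 2.9] -/
theorem KernelTower.exp_one_or_exp_pi_sq_or_exp_I_pi_cube_not_mem_stage_zero :
    Complex.exp 1 ∉ stage 0 ∨ Complex.exp ((Real.pi : ℂ) ^ 2) ∉ stage 0 ∨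
      Complex.exp (Complex.I * (Real.pi : ℂ) ^ 3) ∉ stage 0 := by
  have hxmem : ∀ i, (![(1 : ℂ), ↑Real.pi * Complex.I] : Fin 2 → ℂ) i ∈ stage 0 := by
    intro i
    fin_cases i
    · exact one_mem _
    · exact SixExpStageZero.pi_mul_I_mem
  have hymem :
      ∀ j, (![(1 : ℂ), ↑Real.pi * Complex.I, (Real.pi : ℂ) ^ 2] : Fin 3 → ℂ) j ∈ stage 0 := by
    intro j
    fin_cases j
    · exact one_mem _
    · exact SixExpStageZero.pi_mul_I_mem
    · exact SixExpStageZero.pi_sq_mem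
  obtain ⟨i, j, hij⟩ := stub_sixExponentialsStageZero _ _ hxmem hymem
    SixExpStageZero.linearIndependent_one_pi_mul_I
    SixExpStageZero.linearIndependent_one_pi_mul_I_pi_sq
  have hneg1 : (-1 : ℂ) ∈ stage 0 := neg_mem (one_mem _)
  have e11 : (↑Real.pi * Complex.I : ℂ) * (↑Real.pi * Complex.I) = -((Real.pi : ℂ) ^ 2) := by
    rw [mul_mul_mul_comm, Complex.I_mul_I]; ring
  have e12 : (↑Real.pi * Complex.I : ℂ) * (Real.pi : ℂ) ^ 2 = Complex.I * (Real.pi : ℂ) ^ 3 := by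
    ring
  fin_cases i <;> fin_cases j <;>
    simp only [Fin.zero_eta, Fin.mk_one, Fin.reduceFinMk, Matrix.cons_val, one_mul,
      mul_one] at hij
  · exact Or.inl hij
  · exact absurd (by rw [Complex.exp_pi_mul_I]; exact hneg1) hij
  · exact Or.inr (Or.inl hij)
  · exact absurd (by rw [Complex.exp_pi_mul_I]; exact hneg1) hij
  · refine Or.inr (Or.inl fun h => hij ?_)
    rw [e11, Complex.exp_neg]
    exact inv_mem h
  · rw [e12] at hij
    exact Or.inr (Or.inr hij)

/-- **At least one of `e^{π²}`, `e^{iπ³}`, `e^{π⁴}` is transcendental over `ℚ(π)`** (not all three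
lie in `L₀ = stage 0`): the `e`-free companion of
`KernelTower.exp_one_or_exp_pi_sq_or_exp_I_pi_cube_not_mem_stage_zero`, from
`stub_sixExponentialsStageZero` at `x = (πi, π²)`, `y = (1, πi, π²)` — products
`πi, −π², iπ³, π², iπ³, π⁴`, exponentials `−1, e^{−π²}, e^{iπ³}, e^{π²}, e^{iπ³}, e^{π⁴}`.  Again an
unconditional disjunction of open instances of `RelLW₀` (relative form of the six exponentials
theorem at these points). [cite: NesterenkoPhilippon2001, Ch. 14 Theorem 2.9] -/
theorem KernelTower.exp_pi_sq_or_exp_I_pi_cube_or_exp_pi_fourth_not_mem_stage_zero :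
    Complex.exp ((Real.pi : ℂ) ^ 2) ∉ stage 0 ∨
      Complex.exp (Complex.I * (Real.pi : ℂ) ^ 3) ∉ stage 0 ∨
        Complex.exp ((Real.pi : ℂ) ^ 4) ∉ stage 0 := by
  have hxmem :
      ∀ i, (![(↑Real.pi * Complex.I : ℂ), (Real.pi : ℂ) ^ 2] : Fin 2 → ℂ) i ∈ stage 0 := by
    intro i
    fin_cases i
    · exact SixExpStageZero.pi_mul_I_mem
    · exact SixExpStageZero.pi_sq_mem
  have hymem :
      ∀ j, (![(1 : ℂ), ↑Real.pi * Complex.I, (Real.pi : ℂ) ^ 2] : Fin 3 → ℂ) j ∈ stage 0 := by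
    intro j
    fin_cases j
    · exact one_mem _
    · exact SixExpStageZero.pi_mul_I_mem
    · exact SixExpStageZero.pi_sq_mem
  obtain ⟨i, j, hij⟩ := stub_sixExponentialsStageZero _ _ hxmem hymem
    SixExpStageZero.linearIndependent_pi_mul_I_pi_sq
    SixExpStageZero.linearIndependent_one_pi_mul_I_pi_sq
  have hneg1 : (-1 : ℂ) ∈ stage 0 := neg_mem (one_mem _)
  have e01 : (↑Real.pi * Complex.I : ℂ) * (↑Real.pi * Complex.I) = -((Real.pi : ℂ) ^ 2) := by
    rw [mul_mul_mul_comm, Complex.I_mul_I]; ring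
  have e02 : (↑Real.pi * Complex.I : ℂ) * (Real.pi : ℂ) ^ 2 = Complex.I * (Real.pi : ℂ) ^ 3 := by
    ring
  have e11 : (Real.pi : ℂ) ^ 2 * (↑Real.pi * Complex.I) = Complex.I * (Real.pi : ℂ) ^ 3 := by
    ring
  have e12 : (Real.pi : ℂ) ^ 2 * (Real.pi : ℂ) ^ 2 = (Real.pi : ℂ) ^ 4 := by ring
  fin_cases i <;> fin_cases j <;>
    simp only [Fin.zero_eta, Fin.mk_one, Fin.reduceFinMk, Matrix.cons_val, mul_one] at hij
  · exact absurd (by rw [Complex.exp_pi_mul_I]; exact hneg1) hij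
  · refine Or.inl fun h => hij ?_
    rw [e01, Complex.exp_neg]
    exact inv_mem h
  · rw [e02] at hij
    exact Or.inr (Or.inl hij)
  · exact Or.inl hij
  · rw [e11] at hij
    exact Or.inr (Or.inl hij)
  · rw [e12] at hij
    exact Or.inr (Or.inr hij)

end Summit.Schanuel.Schanuel.Theorems.RigidCore

end
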